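import Summits.QuantumFields.YangMills.Theorems.BalabanUVNodesN15CovariantAveragingHolonomyFit
import Summits.QuantumFields.YangMills.Theorems.BalabanUVNodesN15CovariantTwoGridPullbackTwistDataUN
import Summits.QuantumFields.YangMills.Theorems.BalabanUVNodesN15CurvedGluingLocalGaugesSpeciesUN
import Summits.QuantumFields.YangMills.Theorems.BalabanUVNodesN15PerCubeGreenFineObjects
import Summits.QuantumFields.YangMills.Theorems.BalabanUVNodesN15PerCubeGreenObjects
import HarnessLib

/-!
# N15 = NE2, road (c) — PROGRAMME (PC) «[B9] Sect. C FOR THE LANDAU LETTER WITH PER-CUBE GAUGES (3.35) AS PRINTED», (PC-E) (C6-c): THE COARSE POINTWISE LETTERS IN THE INDUCED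
# GAUGE FROM THE FINE ONES UNDER THE COVARIANT PAIRING — if the coarse bond variable is the straight fine holonomy `U_μ(x) = Π_{t<L^m} U′_μ(σx + te′_μ)` (the main term (125) of
# Bałaban's average), then `u′(σx)·U_μ(x)·u′(σ(x+e_μ))ᴴ = Π_t V′_μ(σx + te′_μ)` TELESCOPES into the transformed fine bond variables `V′ = u′U′u′(·+e′)ᴴ`, so the coarse letters of
# n15-c∕340 follow from the fine ones: `‖V − 1‖ ≤ (1+η′p)^{L^m} − 1`, `‖V_μ(x) − V_μ(x−e_μ)‖ ≤ L^m·L^m·η′²q·(1+η′p)^{L^m} = η²q(1+η′p)^{L^m}` (dag-n15-c g32, n15-c∕341)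

Cell `pub-ymgap`, seat `pub-ymgap-dag-n15-c` (generation g32; R134 (a) seat, strategy s1 «first missing estimate»; HUMAN RULING D-0062; chair R424 venue).
`bears_on: R4∕N15 · K3⁸ SpineGivenEndpointR13SepCoPHV (stmt-QuantumFields-27366)`; filed `--kind proof --supports stmt-QuantumFields-27366 --as helper` — COUNT-NEUTRAL.
THEOREMS only ([folklore] product algebra on King's torus pair), 0 `def`, 0 `sorry`.  Imports BY NAME n15-c g21 `…CovariantAveragingHolonomyFit` (`norm_mprod_sub_one_le`,
`norm_mprod_sub_mprod_le`; through it n15-c∕181 `mprod`, `mprod_zero`, `mprod_succ`, `mprod_congr`), n15-c∕337 `…CovariantTwoGridPullbackTwistDataUN` (through it dag-n15-a `kingSec`,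
`kingSec_val`, `unitVec`), dag-n15-w2 `…CurvedGluingLocalGaugesSpeciesUN` (`uN_gaugeTransformed_bond_unitary`), n15-c∕260∕260′ `…PerCubeGreen(Fine)Objects` (`ScX`, `ScX′`,
`scShift`, `scShift′`).  Nothing in the tree is modified, no landed name re-declared.

WHY (n15-c∕340 `uN_idef_scGreen_tr`, HOME `PCE-DESIGN-g31.md` §2 «covariant × (i)»).  340 displays, next to the fine (3.35) letters `‖V′_μ(z) − 1‖ ≤ η′p`, `‖V′_μ(z) − V′_μ(z−e′_μ)‖ ≤ η′²q`
of the transformed fine bond variables in the cube gauge `u′_k`, the SAME letters for the coarse variables `V_μ(x) = u′_k(σx)U_μ(x)u′_k(σ(x+e_μ))ᴴ` in the INDUCED gauge `u′_k∘σ` — the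
covariant fit of the pairing.  For the COVARIANT PAIRING (i) «coarse bond variable := the fine holonomy along the straight path of `L^m` fine bonds from `σx`» (the main term (125) of
[Balaban1985Averaging] (124); King's pairing `σ` = block base point) these are CONSEQUENCES of the fine letters: `σ(x + e_μ) = σx + L^m·e′_μ` (★ `kingSec_add_unitVec`), so inserting
`u′(z)ᴴu′(z) = 1` between consecutive factors TELESCOPES `u′(σx)·Π_tU′_μ(σx+te′)·u′(σx+L^me′)ᴴ = Π_t V′_μ(σx+te′)` (★ `mprod_conjTranspose_telescope`, the `U(m)` twin of n15-c∕198
`mprod_telescope`); a product of `L^m` unitaries each within `κ` of `1` is within `(1+κ)^{L^m} − 1` of `1`, and two such products differ by at most `(Σ_t‖F_t − G_t‖)(1+κ)^{L^m}`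
(n15-c g21), each factor pair `V′_μ(σx+te′), V′_μ(σx+te′−L^me′)` being `L^m` backward steps apart (`dist_le_range_sum_dist`).

RESULTS ([folklore]; `σ = kingSec M L k m`, `e′_μ = unitVec (fine (L^mL^k) M) μ`, `e_μ = unitVec (fine (L^k) M) μ`).
* §1 `mprod_conjTranspose_telescope`; ★ `kingSec_add_unitVec` (`σ(x + e_μ) = σx + L^m • e′_μ`), `kingSec_sub_unitVec`.
* §2 ★★ `gauged_lineHol_eq_mprod` (the telescoping identity), ★★ `norm_gauged_lineHol_sub_one_le` (`‖V_μ(x) − 1‖ ≤ (1+κ)^{L^m} − 1`), `norm_chain_sub_le` (`‖a₀ − a_N‖ ≤ N·κ₂` along a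
  chain), ★★ `norm_gauged_lineHol_sub_gauged_lineHol_le` (`‖V_μ(x) − V_μ(x − e_μ)‖ ≤ (L^m·(L^m·κ₂))·(1+κ)^{L^m}`).
* §3 ((PC) site carriers, n15-c∕260∕260′ objects) ★★ `norm_scGauged_pairing_letters`: n15-c∕340's `hC1`∕`hC2` at a coarse site from its `hF1`∕`hF2` on the two fine lines over it, under the
  pairing `U_μ = Π_{t<L^r}U′_μ(σ· + te′_μ)`: `p_c = ((1+η′p)^{L^r} − 1)∕η`, `q_c = q(1+η′p)^{L^r}`.

HONEST FRAMING ∕ LIMITS.  Product algebra only (no analysis); the pairing is the MODEL one (straight holonomy = main term of (124), no lower-order averaging corrections, one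
averaging level); nothing of [B7]∕[B9] asserted ((124)–(126) p.36, (3.35) p.396 = SHAPES).  NE2⁺ NOT PRINTED, NOT proved; N15 of record untouched (DISCHARGED AS CONSUMED, p687738);
K3⁸ OPEN; counts of record UNMOVED (typed 28∕28 · discharged 8∕27); one finite 𝕋⁴ at fixed ε per index — NOT infinite volume, NOT OS on ℝ⁴, NOT a mass gap, NOT Clay; R4 closes the
conditional finite-𝕋⁴ rung `BalabanLadder.UV` only.  Restate-immune (no Theses import).
-/

noncomputable section

open scoped BigOperators Matrix Matrix.Norms.L2Operator
open Finset

namespace Summit.QuantumFields.YangMills.BalabanUVNodes.N15.CovAvg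

open Literature.MathematicalPhysics.QuantumFieldTheory.Balaban1983to89
open Literature.MathematicalPhysics.QuantumFieldTheory.Balaban1983to89.B5Prop11Plancherel (Tor fine unitVec)
open Summit.QuantumFields.YangMills.BalabanUVNodes.N15.CurvedSpecies (uN_gaugeTransformed_bond_unitary)

variable {d : ℕ}

/-! ## §1 Telescoping through unitary gauges; the section and the shifts -/

section Algebra

variable {mm : Type} [Fintype mm] [DecidableEq mm]

/-- ★ **TELESCOPING THROUGH A UNITARY GAUGE** (the `U(m)` twin of n15-c∕198 `mprod_telescope`): `Π_{t<N} (w(z_t)·F_t·w(z_{t+1})ᴴ) = w(z_0)·(Π_{t<N} F_t)·w(z_N)ᴴ` when `w(z)ᴴw(z) = 1`.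
[cite: Balaban1985BackgroundPropagators, (3.28) p.395, (3.31) p.395 (gauge covariance of holonomies: shape)] -/
theorem mprod_conjTranspose_telescope {X : Type} (z : ℕ → X) {w : X → Matrix mm mm ℂ} (hw : ∀ x, (w x)ᴴ * w x = 1) (F : ℕ → Matrix mm mm ℂ) (N : ℕ) :
    mprod (fun t => w (z t) * F t * (w (z (t + 1)))ᴴ) N = w (z 0) * mprod F N * (w (z N))ᴴ := by
  induction N with
  | zero => rw [mprod_zero, mprod_zero, Matrix.mul_one, mul_eq_one_comm.mp (hw (z 0))]
  | succ N ih =>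
      rw [mprod_succ, mprod_succ, ih]
      simp only [Matrix.mul_assoc]
      rw [← Matrix.mul_assoc (w (z N))ᴴ, hw, Matrix.one_mul]

/-- `‖a_0 − a_N‖ ≤ N·κ` along a chain with steps `‖a_t − a_{t+1}‖ ≤ κ` (Mathlib `dist_le_range_sum_dist`). [folklore] -/
theorem norm_chain_sub_le {E : Type} [SeminormedAddCommGroup E] (a : ℕ → E) {κ : ℝ} {N : ℕ} (h : ∀ t < N, ‖a t - a (t + 1)‖ ≤ κ) : ‖a 0 - a N‖ ≤ N * κ := by
  have h1 := dist_le_range_sum_dist a N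
  rw [dist_eq_norm] at h1
  refine h1.trans ?_
  calc ∑ i ∈ range N, dist (a i) (a (i + 1)) ≤ ∑ _i ∈ range N, κ := Finset.sum_le_sum fun i hi => by rw [dist_eq_norm]; exact h i (Finset.mem_range.mp hi)
    _ = N * κ := by rw [Finset.sum_const, Finset.card_range, nsmul_eq_mul]

variable (M : Fin (d + 1) → ℕ) [∀ μ, NeZero (M μ)] (L k m : ℕ) [NeZero L]

/-- ★ **THE SECTION AND THE SHIFTS**: `σ(x + e_μ) = σ(x) + L^m·e′_μ` — one coarse step is `L^m` fine steps from the block base point. [cite: King1986, p.664 (pairing convention)] -/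
theorem kingSec_add_unitVec (x : Tor (fine (L ^ k) M)) (μ : Fin (d + 1)) :
    kingSec M L k m (x + unitVec (fine (L ^ k) M) μ) = kingSec M L k m x + (L ^ m) • unitVec (fine (L ^ m * L ^ k) M) μ := by
  funext ν
  by_cases hν : ν = μ
  · subst hν
    have h1 : (x + unitVec (fine (L ^ k) M) ν) ν = x ν + 1 := by simp [unitVec]
    have h2 : (kingSec M L k m x + (L ^ m) • unitVec (fine (L ^ m * L ^ k) M) ν) ν = kingSec M L k m x ν + ((L ^ m : ℕ) : ZMod (fine (L ^ m * L ^ k) M ν)) := by simp [unitVec]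
    rw [h2]
    simp only [kingSec]
    rw [h1, ← Nat.cast_add, ZMod.natCast_eq_natCast_iff', ZMod.val_add, ZMod.val_one_eq_one_mod, Nat.add_mod_mod]
    show L ^ m * (((x ν).val + 1) % (L ^ k * M ν)) % (L ^ m * L ^ k * M ν) = (L ^ m * (x ν).val + L ^ m) % (L ^ m * L ^ k * M ν)
    rw [Nat.mul_assoc, Nat.mul_mod_mul_left, Nat.mod_mod, ← Nat.mul_add_one, Nat.mul_mod_mul_left]
  · have h1 : (x + unitVec (fine (L ^ k) M) μ) ν = x ν := by simp [unitVec, hν]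
    have h2 : (kingSec M L k m x + (L ^ m) • unitVec (fine (L ^ m * L ^ k) M) μ) ν = kingSec M L k m x ν := by simp [unitVec, hν]
    rw [h2]
    simp only [kingSec]
    rw [h1]

/-- … and `σ(x − e_μ) = σ(x) − L^m·e′_μ`. [cite: King1986, p.664 (pairing convention)] -/
theorem kingSec_sub_unitVec (x : Tor (fine (L ^ k) M)) (μ : Fin (d + 1)) :
    kingSec M L k m (x - unitVec (fine (L ^ k) M) μ) = kingSec M L k m x - (L ^ m) • unitVec (fine (L ^ m * L ^ k) M) μ := by
  rw [eq_sub_iff_add_eq, ← kingSec_add_unitVec, sub_add_cancel]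

end Algebra

/-! ## §2 The coarse transformed bond variable under the covariant pairing: telescoping and the two letters -/

section Pairing

variable (M : Fin (d + 1) → ℕ) [∀ μ, NeZero (M μ)] (L k m : ℕ) [NeZero L] {mm : Type} [Fintype mm] [DecidableEq mm]

/-- ★★ **THE TELESCOPING IDENTITY**: in the induced gauge `u′∘σ`, the transformed coarse bond variable of the straight fine holonomy is the ordered product of the transformed fine bond
variables along the path: `u′(σx)·(Π_{t<L^m} U′_μ(σx + te′_μ))·u′(σ(x + e_μ))ᴴ = Π_{t<L^m} (u′(z_t)U′_μ(z_t)u′(z_t + e′_μ)ᴴ)`, `z_t = σx + te′_μ`.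
[cite: Balaban1985Averaging, (124)–(125) p.36 (the straight holonomy: shape); Balaban1985BackgroundPropagators, (3.31) p.395 (covariance: shape)] -/
theorem gauged_lineHol_eq_mprod {u' : Tor (fine (L ^ m * L ^ k) M) → Matrix mm mm ℂ} (hu' : ∀ z, (u' z)ᴴ * u' z = 1) (U' : Fin (d + 1) → Tor (fine (L ^ m * L ^ k) M) → Matrix mm mm ℂ)
    (μ : Fin (d + 1)) (x : Tor (fine (L ^ k) M)) :
    u' (kingSec M L k m x) * mprod (fun t => U' μ (kingSec M L k m x + t • unitVec (fine (L ^ m * L ^ k) M) μ)) (L ^ m) * (u' (kingSec M L k m (x + unitVec (fine (L ^ k) M) μ)))ᴴ =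
      mprod (fun t => u' (kingSec M L k m x + t • unitVec (fine (L ^ m * L ^ k) M) μ) * U' μ (kingSec M L k m x + t • unitVec (fine (L ^ m * L ^ k) M) μ) *
        (u' (kingSec M L k m x + t • unitVec (fine (L ^ m * L ^ k) M) μ + unitVec (fine (L ^ m * L ^ k) M) μ))ᴴ) (L ^ m) := by
  have h := mprod_conjTranspose_telescope (fun t : ℕ => kingSec M L k m x + t • unitVec (fine (L ^ m * L ^ k) M) μ) hu' (fun t => U' μ (kingSec M L k m x + t • unitVec (fine (L ^ m * L ^ k) M) μ)) (L ^ m)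
  simp only [zero_smul, add_zero, succ_nsmul, ← add_assoc] at h
  rw [kingSec_add_unitVec, ← h]

/-- ★★ **THE FIRST COARSE LETTER** («U − 1 small in the induced gauge»): if the transformed fine bond variables along the path are each within `κ` of `1`, then
`‖u′(σx)·U_μ(x)·u′(σ(x+e_μ))ᴴ − 1‖ ≤ (1+κ)^{L^m} − 1` for the straight holonomy `U_μ(x)` (`≈ L^mκ = η·p` for `κ = η′p`).
[cite: Balaban1985BackgroundPropagators, (3.35) p.396 (shape); Balaban1985Averaging, (126) p.36 («|(Q₀A)| ≤ |A|»: shape)] -/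
theorem norm_gauged_lineHol_sub_one_le {u' : Tor (fine (L ^ m * L ^ k) M) → Matrix mm mm ℂ} (hu' : ∀ z, (u' z)ᴴ * u' z = 1) (U' : Fin (d + 1) → Tor (fine (L ^ m * L ^ k) M) → Matrix mm mm ℂ)
    {κ : ℝ} (hκ : 0 ≤ κ) (μ : Fin (d + 1)) (x : Tor (fine (L ^ k) M))
    (hpath : ∀ t < L ^ m, ‖u' (kingSec M L k m x + t • unitVec (fine (L ^ m * L ^ k) M) μ) * U' μ (kingSec M L k m x + t • unitVec (fine (L ^ m * L ^ k) M) μ) *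
      (u' (kingSec M L k m x + t • unitVec (fine (L ^ m * L ^ k) M) μ + unitVec (fine (L ^ m * L ^ k) M) μ))ᴴ - 1‖ ≤ κ) :
    ‖u' (kingSec M L k m x) * mprod (fun t => U' μ (kingSec M L k m x + t • unitVec (fine (L ^ m * L ^ k) M) μ)) (L ^ m) * (u' (kingSec M L k m (x + unitVec (fine (L ^ k) M) μ)))ᴴ - 1‖ ≤
      (1 + κ) ^ (L ^ m) - 1 := by
  rw [gauged_lineHol_eq_mprod M L k m hu' U' μ x]
  exact norm_mprod_sub_one_le hκ hpath

/-- ★★ **THE SECOND COARSE LETTER** (the backward difference in the induced gauge): if the transformed fine bond variables on the two paths are each within `κ` of `1` and consecutive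
ones (one fine step back in direction `μ`) within `κ₂`, then `‖V_μ(x) − V_μ(x − e_μ)‖ ≤ (L^m·(L^m·κ₂))·(1+κ)^{L^m}` for the straight holonomies in the induced gauge
(`= η²q·(1+η′p)^{L^m}` at `κ₂ = η′²q`, `L^mη′ = η`). [cite: Balaban1985BackgroundPropagators, (3.35) p.396, (3.52) p.400 (shape); Balaban1985Averaging, (126) p.36 (shape)] -/
theorem norm_gauged_lineHol_sub_gauged_lineHol_le {u' : Tor (fine (L ^ m * L ^ k) M) → Matrix mm mm ℂ} (hu' : ∀ z, (u' z)ᴴ * u' z = 1)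
    (U' : Fin (d + 1) → Tor (fine (L ^ m * L ^ k) M) → Matrix mm mm ℂ) {κ κ₂ : ℝ} (hκ : 0 ≤ κ) (μ : Fin (d + 1)) (x : Tor (fine (L ^ k) M))
    (hpath : ∀ t < L ^ m, ‖u' (kingSec M L k m x + t • unitVec (fine (L ^ m * L ^ k) M) μ) * U' μ (kingSec M L k m x + t • unitVec (fine (L ^ m * L ^ k) M) μ) *
      (u' (kingSec M L k m x + t • unitVec (fine (L ^ m * L ^ k) M) μ + unitVec (fine (L ^ m * L ^ k) M) μ))ᴴ - 1‖ ≤ κ)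
    (hpath' : ∀ t < L ^ m, ‖u' (kingSec M L k m (x - unitVec (fine (L ^ k) M) μ) + t • unitVec (fine (L ^ m * L ^ k) M) μ) *
      U' μ (kingSec M L k m (x - unitVec (fine (L ^ k) M) μ) + t • unitVec (fine (L ^ m * L ^ k) M) μ) *
      (u' (kingSec M L k m (x - unitVec (fine (L ^ k) M) μ) + t • unitVec (fine (L ^ m * L ^ k) M) μ + unitVec (fine (L ^ m * L ^ k) M) μ))ᴴ - 1‖ ≤ κ)
    (hstep : ∀ t < L ^ m, ∀ s < L ^ m, ‖u' (kingSec M L k m x + t • unitVec (fine (L ^ m * L ^ k) M) μ - s • unitVec (fine (L ^ m * L ^ k) M) μ) *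
        U' μ (kingSec M L k m x + t • unitVec (fine (L ^ m * L ^ k) M) μ - s • unitVec (fine (L ^ m * L ^ k) M) μ) *
        (u' (kingSec M L k m x + t • unitVec (fine (L ^ m * L ^ k) M) μ - s • unitVec (fine (L ^ m * L ^ k) M) μ + unitVec (fine (L ^ m * L ^ k) M) μ))ᴴ -
      u' (kingSec M L k m x + t • unitVec (fine (L ^ m * L ^ k) M) μ - (s + 1) • unitVec (fine (L ^ m * L ^ k) M) μ) *
        U' μ (kingSec M L k m x + t • unitVec (fine (L ^ m * L ^ k) M) μ - (s + 1) • unitVec (fine (L ^ m * L ^ k) M) μ) *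
        (u' (kingSec M L k m x + t • unitVec (fine (L ^ m * L ^ k) M) μ - (s + 1) • unitVec (fine (L ^ m * L ^ k) M) μ + unitVec (fine (L ^ m * L ^ k) M) μ))ᴴ‖ ≤ κ₂) :
    ‖u' (kingSec M L k m x) * mprod (fun t => U' μ (kingSec M L k m x + t • unitVec (fine (L ^ m * L ^ k) M) μ)) (L ^ m) * (u' (kingSec M L k m (x + unitVec (fine (L ^ k) M) μ)))ᴴ -
      u' (kingSec M L k m (x - unitVec (fine (L ^ k) M) μ)) * mprod (fun t => U' μ (kingSec M L k m (x - unitVec (fine (L ^ k) M) μ) + t • unitVec (fine (L ^ m * L ^ k) M) μ)) (L ^ m) *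
        (u' (kingSec M L k m x))ᴴ‖ ≤ (L ^ m * (L ^ m * κ₂)) * (1 + κ) ^ (L ^ m) := by
  have h2 := gauged_lineHol_eq_mprod M L k m hu' U' μ (x - unitVec (fine (L ^ k) M) μ)
  rw [sub_add_cancel] at h2
  rw [gauged_lineHol_eq_mprod M L k m hu' U' μ x, h2]
  refine (norm_mprod_sub_mprod_le hκ hpath hpath').trans (mul_le_mul_of_nonneg_right ?_ (by positivity))
  -- each factor pair is `L^m` backward fine steps apart
  have hz : ∀ t : ℕ, kingSec M L k m (x - unitVec (fine (L ^ k) M) μ) + t • unitVec (fine (L ^ m * L ^ k) M) μ =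
      kingSec M L k m x + t • unitVec (fine (L ^ m * L ^ k) M) μ - (L ^ m) • unitVec (fine (L ^ m * L ^ k) M) μ := fun t => by
    rw [kingSec_sub_unitVec]; abel
  calc ∑ t ∈ range (L ^ m), ‖u' (kingSec M L k m x + t • unitVec (fine (L ^ m * L ^ k) M) μ) * U' μ (kingSec M L k m x + t • unitVec (fine (L ^ m * L ^ k) M) μ) *
          (u' (kingSec M L k m x + t • unitVec (fine (L ^ m * L ^ k) M) μ + unitVec (fine (L ^ m * L ^ k) M) μ))ᴴ -
        u' (kingSec M L k m (x - unitVec (fine (L ^ k) M) μ) + t • unitVec (fine (L ^ m * L ^ k) M) μ) * U' μ (kingSec M L k m (x - unitVec (fine (L ^ k) M) μ) + t • unitVec (fine (L ^ m * L ^ k) M) μ) *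
          (u' (kingSec M L k m (x - unitVec (fine (L ^ k) M) μ) + t • unitVec (fine (L ^ m * L ^ k) M) μ + unitVec (fine (L ^ m * L ^ k) M) μ))ᴴ‖
      ≤ ∑ _t ∈ range (L ^ m), ((L ^ m : ℕ) : ℝ) * κ₂ := Finset.sum_le_sum fun t ht => by
        rw [hz t]
        have hc := norm_chain_sub_le (fun s : ℕ => u' (kingSec M L k m x + t • unitVec (fine (L ^ m * L ^ k) M) μ - s • unitVec (fine (L ^ m * L ^ k) M) μ) *
            U' μ (kingSec M L k m x + t • unitVec (fine (L ^ m * L ^ k) M) μ - s • unitVec (fine (L ^ m * L ^ k) M) μ) *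
            (u' (kingSec M L k m x + t • unitVec (fine (L ^ m * L ^ k) M) μ - s • unitVec (fine (L ^ m * L ^ k) M) μ + unitVec (fine (L ^ m * L ^ k) M) μ))ᴴ) (N := L ^ m)
          (fun s hs => hstep t (Finset.mem_range.mp ht) s hs)
        simp only [zero_smul, sub_zero] at hc
        exact hc
    _ = L ^ m * (L ^ m * κ₂) := by rw [Finset.sum_const, Finset.card_range, nsmul_eq_mul]; push_cast; ring

end Pairing

end Summit.QuantumFields.YangMills.BalabanUVNodes.N15.CovAvg

/-! ## §3 On the (PC) site carriers: n15-c∕340's coarse letters from its fine ones under the covariant pairing -/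

namespace Summit.QuantumFields.YangMills.BalabanUVNodes.N15.Gluing

open Literature.MathematicalPhysics.QuantumFieldTheory.Balaban1983to89
open Literature.MathematicalPhysics.QuantumFieldTheory.Balaban1983to89.B5Prop11Plancherel (Tor fine unitVec)
open Summit.QuantumFields.YangMills.BalabanUVNodes.N15.CovAvg (mprod kingSec kingSec_add_unitVec kingSec_sub_unitVec norm_gauged_lineHol_sub_one_le norm_gauged_lineHol_sub_gauged_lineHol_le)

variable {d : ℕ} {L : ℕ} [NeZero L] {mv kk r : ℕ} {hL : Odd L ∧ 1 < L} {mm : Type} [Fintype mm] [DecidableEq mm]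

/-- ★★ **n15-c∕340's COARSE POINTWISE LETTERS FROM ITS FINE ONES, UNDER THE COVARIANT PAIRING (i)**: on the (PC) site carriers (`σ = kingSec`, `η′ = (L^rL^k)^{−1}`, `η = L^{−k}`), for a
unitary fine gauge `u′`, a fine bond field `U′` whose transformed bond variables obey the two (3.35) letters `p, q` on a set `Qf`, and the coarse bond field `U_μ := Π_{t<L^r}U′_μ(σ· + te′_μ)`
(the straight fine holonomy): at every coarse site `x` whose two fine lines `σx + te′_μ − se′_μ` (`t < L^r`, `s ≤ L^r`) lie in `Qf`, the transformed coarse bond variable in the INDUCED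
gauge `u′∘σ` satisfies `‖V_μ(x) − 1‖ ≤ η·(((1+η′p)^{L^r} − 1)∕η)` and `‖V_μ(x) − V_μ(x − e_μ)‖ ≤ η²·(q(1+η′p)^{L^r})` — 340's hypotheses `hC1`∕`hC2` with `p_c = ((1+η′p)^{L^r} − 1)∕η`
(`≤ p·e^{ηp}`-sized) and `q_c = q(1+η′p)^{L^r}`. [cite: Balaban1985Averaging, (124)–(126) p.36 (shape); Balaban1985BackgroundPropagators, (3.35) p.396, (3.52) p.400 (shape); King1986, p.664 (pairing)] -/
theorem norm_scGauged_pairing_letters {u' : ScX' d L mv kk r hL → Matrix mm mm ℂ} (hu' : ∀ z, (u' z)ᴴ * u' z = 1) (U' : Fin (d + 1) → ScX' d L mv kk r hL → Matrix mm mm ℂ)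
    {U : Fin (d + 1) → ScX d L mv kk hL → Matrix mm mm ℂ} (μ : Fin (d + 1))
    (hpair : ∀ y, U μ y = mprod (fun t => U' μ (kingSec (cvM d L mv kk hL) L kk r y + t • unitVec (fine (L ^ r * L ^ kk) (cvM d L mv kk hL)) μ)) (L ^ r))
    {Qf : Set (ScX' d L mv kk r hL)} {p q : ℝ} (hp : 0 ≤ p)
    (hF1 : ∀ z, z ∈ Qf → ‖u' z * U' μ z * (u' (scShift' d L mv kk r hL μ z))ᴴ - 1‖ ≤ ((((L ^ r * L ^ kk : ℕ) : ℝ))⁻¹) * p)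
    (hF2 : ∀ z, z ∈ Qf → ‖u' z * U' μ z * (u' (scShift' d L mv kk r hL μ z))ᴴ -
      u' ((scShift' d L mv kk r hL μ).symm z) * U' μ ((scShift' d L mv kk r hL μ).symm z) * (u' (scShift' d L mv kk r hL μ ((scShift' d L mv kk r hL μ).symm z)))ᴴ‖ ≤ ((((L ^ r * L ^ kk : ℕ) : ℝ))⁻¹) ^ 2 * q)
    (x : ScX d L mv kk hL) (hQ : ∀ t < L ^ r, ∀ s ≤ L ^ r, kingSec (cvM d L mv kk hL) L kk r x + t • unitVec (fine (L ^ r * L ^ kk) (cvM d L mv kk hL)) μ - s • unitVec (fine (L ^ r * L ^ kk) (cvM d L mv kk hL)) μ ∈ Qf) :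
    ‖u' (kingSec (cvM d L mv kk hL) L kk r x) * U μ x * (u' (kingSec (cvM d L mv kk hL) L kk r (scShift d L mv kk hL μ x)))ᴴ - 1‖ ≤
        ((((L ^ kk : ℕ) : ℝ))⁻¹) * (((1 + ((((L ^ r * L ^ kk : ℕ) : ℝ))⁻¹) * p) ^ (L ^ r) - 1) / ((((L ^ kk : ℕ) : ℝ))⁻¹)) ∧
      ‖u' (kingSec (cvM d L mv kk hL) L kk r x) * U μ x * (u' (kingSec (cvM d L mv kk hL) L kk r (scShift d L mv kk hL μ x)))ᴴ -
          u' (kingSec (cvM d L mv kk hL) L kk r ((scShift d L mv kk hL μ).symm x)) * U μ ((scShift d L mv kk hL μ).symm x) *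
            (u' (kingSec (cvM d L mv kk hL) L kk r (scShift d L mv kk hL μ ((scShift d L mv kk hL μ).symm x))))ᴴ‖ ≤
        ((((L ^ kk : ℕ) : ℝ))⁻¹) ^ 2 * (q * (1 + ((((L ^ r * L ^ kk : ℕ) : ℝ))⁻¹) * p) ^ (L ^ r)) := by
  have hLpos : 0 < L := Nat.pos_of_ne_zero (NeZero.ne L)
  have hnr : (0 : ℝ) < ((L ^ kk : ℕ) : ℝ) := by exact_mod_cast pow_pos hLpos kk
  have hnr' : (0 : ℝ) < ((L ^ r * L ^ kk : ℕ) : ℝ) := by exact_mod_cast Nat.mul_pos (pow_pos hLpos r) (pow_pos hLpos kk)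
  have hη'0 : (0 : ℝ) ≤ (((L ^ r * L ^ kk : ℕ) : ℝ))⁻¹ := inv_nonneg.mpr hnr'.le
  have hκ : 0 ≤ ((((L ^ r * L ^ kk : ℕ) : ℝ))⁻¹) * p := mul_nonneg hη'0 hp
  -- the shifts are `± e`
  have hsymm : ∀ y : ScX d L mv kk hL, (scShift d L mv kk hL μ).symm y = y - unitVec (fine (L ^ kk) (cvM d L mv kk hL)) μ := fun y => by
    show (Equiv.addRight _).symm y = _; rw [Equiv.addRight_symm]; show y + -_ = _; rw [← sub_eq_add_neg]
  have hsymm' : ∀ z : ScX' d L mv kk r hL, (scShift' d L mv kk r hL μ).symm z = z - unitVec (fine (L ^ r * L ^ kk) (cvM d L mv kk hL)) μ := fun z => by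
    show (Equiv.addRight _).symm z = _; rw [Equiv.addRight_symm]; show z + -_ = _; rw [← sub_eq_add_neg]
  have hback : scShift d L mv kk hL μ ((scShift d L mv kk hL μ).symm x) = x := Equiv.apply_symm_apply _ _
  -- the fine letters at the points of the two lines
  have hpath : ∀ t < L ^ r, ‖u' (kingSec (cvM d L mv kk hL) L kk r x + t • unitVec (fine (L ^ r * L ^ kk) (cvM d L mv kk hL)) μ) *
      U' μ (kingSec (cvM d L mv kk hL) L kk r x + t • unitVec (fine (L ^ r * L ^ kk) (cvM d L mv kk hL)) μ) *
      (u' (kingSec (cvM d L mv kk hL) L kk r x + t • unitVec (fine (L ^ r * L ^ kk) (cvM d L mv kk hL)) μ + unitVec (fine (L ^ r * L ^ kk) (cvM d L mv kk hL)) μ))ᴴ - 1‖ ≤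
      ((((L ^ r * L ^ kk : ℕ) : ℝ))⁻¹) * p := fun t ht => by
    have h := hF1 _ (by simpa only [zero_smul, sub_zero] using hQ t ht 0 (Nat.zero_le _))
    exact h
  have hpath' : ∀ t < L ^ r, ‖u' (kingSec (cvM d L mv kk hL) L kk r (x - unitVec (fine (L ^ kk) (cvM d L mv kk hL)) μ) + t • unitVec (fine (L ^ r * L ^ kk) (cvM d L mv kk hL)) μ) *
      U' μ (kingSec (cvM d L mv kk hL) L kk r (x - unitVec (fine (L ^ kk) (cvM d L mv kk hL)) μ) + t • unitVec (fine (L ^ r * L ^ kk) (cvM d L mv kk hL)) μ) *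
      (u' (kingSec (cvM d L mv kk hL) L kk r (x - unitVec (fine (L ^ kk) (cvM d L mv kk hL)) μ) + t • unitVec (fine (L ^ r * L ^ kk) (cvM d L mv kk hL)) μ + unitVec (fine (L ^ r * L ^ kk) (cvM d L mv kk hL)) μ))ᴴ - 1‖ ≤
      ((((L ^ r * L ^ kk : ℕ) : ℝ))⁻¹) * p := fun t ht => by
    have hz : kingSec (cvM d L mv kk hL) L kk r (x - unitVec (fine (L ^ kk) (cvM d L mv kk hL)) μ) + t • unitVec (fine (L ^ r * L ^ kk) (cvM d L mv kk hL)) μ =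
        kingSec (cvM d L mv kk hL) L kk r x + t • unitVec (fine (L ^ r * L ^ kk) (cvM d L mv kk hL)) μ - (L ^ r) • unitVec (fine (L ^ r * L ^ kk) (cvM d L mv kk hL)) μ := by
      rw [kingSec_sub_unitVec]; abel
    rw [hz]; exact hF1 _ (hQ t ht (L ^ r) le_rfl)
  have hstep : ∀ t < L ^ r, ∀ s < L ^ r, ‖u' (kingSec (cvM d L mv kk hL) L kk r x + t • unitVec (fine (L ^ r * L ^ kk) (cvM d L mv kk hL)) μ - s • unitVec (fine (L ^ r * L ^ kk) (cvM d L mv kk hL)) μ) *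
        U' μ (kingSec (cvM d L mv kk hL) L kk r x + t • unitVec (fine (L ^ r * L ^ kk) (cvM d L mv kk hL)) μ - s • unitVec (fine (L ^ r * L ^ kk) (cvM d L mv kk hL)) μ) *
        (u' (kingSec (cvM d L mv kk hL) L kk r x + t • unitVec (fine (L ^ r * L ^ kk) (cvM d L mv kk hL)) μ - s • unitVec (fine (L ^ r * L ^ kk) (cvM d L mv kk hL)) μ + unitVec (fine (L ^ r * L ^ kk) (cvM d L mv kk hL)) μ))ᴴ -
      u' (kingSec (cvM d L mv kk hL) L kk r x + t • unitVec (fine (L ^ r * L ^ kk) (cvM d L mv kk hL)) μ - (s + 1) • unitVec (fine (L ^ r * L ^ kk) (cvM d L mv kk hL)) μ) *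
        U' μ (kingSec (cvM d L mv kk hL) L kk r x + t • unitVec (fine (L ^ r * L ^ kk) (cvM d L mv kk hL)) μ - (s + 1) • unitVec (fine (L ^ r * L ^ kk) (cvM d L mv kk hL)) μ) *
        (u' (kingSec (cvM d L mv kk hL) L kk r x + t • unitVec (fine (L ^ r * L ^ kk) (cvM d L mv kk hL)) μ - (s + 1) • unitVec (fine (L ^ r * L ^ kk) (cvM d L mv kk hL)) μ + unitVec (fine (L ^ r * L ^ kk) (cvM d L mv kk hL)) μ))ᴴ‖ ≤
      ((((L ^ r * L ^ kk : ℕ) : ℝ))⁻¹) ^ 2 * q := fun t ht s hs => by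
    have h := hF2 _ (hQ t ht s hs.le)
    have e0 : scShift' d L mv kk r hL μ (kingSec (cvM d L mv kk hL) L kk r x + t • unitVec (fine (L ^ r * L ^ kk) (cvM d L mv kk hL)) μ - s • unitVec (fine (L ^ r * L ^ kk) (cvM d L mv kk hL)) μ) =
        kingSec (cvM d L mv kk hL) L kk r x + t • unitVec (fine (L ^ r * L ^ kk) (cvM d L mv kk hL)) μ - s • unitVec (fine (L ^ r * L ^ kk) (cvM d L mv kk hL)) μ + unitVec (fine (L ^ r * L ^ kk) (cvM d L mv kk hL)) μ := rfl
    have e1 : (scShift' d L mv kk r hL μ).symm (kingSec (cvM d L mv kk hL) L kk r x + t • unitVec (fine (L ^ r * L ^ kk) (cvM d L mv kk hL)) μ - s • unitVec (fine (L ^ r * L ^ kk) (cvM d L mv kk hL)) μ) =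
        kingSec (cvM d L mv kk hL) L kk r x + t • unitVec (fine (L ^ r * L ^ kk) (cvM d L mv kk hL)) μ - (s + 1) • unitVec (fine (L ^ r * L ^ kk) (cvM d L mv kk hL)) μ := by
      rw [hsymm', succ_nsmul]; abel
    have e2 : scShift' d L mv kk r hL μ (kingSec (cvM d L mv kk hL) L kk r x + t • unitVec (fine (L ^ r * L ^ kk) (cvM d L mv kk hL)) μ - (s + 1) • unitVec (fine (L ^ r * L ^ kk) (cvM d L mv kk hL)) μ) =
        kingSec (cvM d L mv kk hL) L kk r x + t • unitVec (fine (L ^ r * L ^ kk) (cvM d L mv kk hL)) μ - (s + 1) • unitVec (fine (L ^ r * L ^ kk) (cvM d L mv kk hL)) μ + unitVec (fine (L ^ r * L ^ kk) (cvM d L mv kk hL)) μ := rfl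
    rw [e0, e1, e2] at h
    exact h
  -- the two letters of §2, then the numerics `L^r·η′ = η`
  have hηη : ((L ^ r : ℕ) : ℝ) * ((((L ^ r * L ^ kk : ℕ) : ℝ))⁻¹) = (((L ^ kk : ℕ) : ℝ))⁻¹ := by
    rw [Nat.cast_mul, mul_inv, ← mul_assoc, mul_inv_cancel₀ (by exact_mod_cast (pow_pos hLpos r).ne'), one_mul]
  have hfwd : scShift d L mv kk hL μ x = x + unitVec (fine (L ^ kk) (cvM d L mv kk hL)) μ := rfl
  refine ⟨?_, ?_⟩
  · rw [mul_div_cancel₀ _ (inv_pos.mpr hnr).ne', hpair x, hfwd]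
    exact norm_gauged_lineHol_sub_one_le (cvM d L mv kk hL) L kk r hu' U' hκ μ x hpath
  · rw [hback, hsymm, hpair x, hpair (x - unitVec (fine (L ^ kk) (cvM d L mv kk hL)) μ), hfwd]
    refine (norm_gauged_lineHol_sub_gauged_lineHol_le (cvM d L mv kk hL) L kk r hu' U' hκ μ x hpath hpath' hstep).trans (le_of_eq ?_)
    rw [← hηη]; push_cast; ring

end Summit.QuantumFields.YangMills.BalabanUVNodes.N15.Gluing

end
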